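import Mathlib.FieldTheory.IsAlgClosed.AlgebraicClosure
import Literature.AlgebraicGeometry.Motives.RelativePeriods
import Literature.NumberTheory.Transcendental.KZPeriods
import HarnessLib

-- provenance: harness21/H21/H21/Statements/Periods/CohomologicalPeriods.lean @ 966583b (interim HEAD d8f2665); M5 mechanical rewrite
/-!
# Cohomological periods are the Kontsevich–Zagier periods (family `periods`, trunk MotiveL)

Let `ℚ̄ = AlgebraicClosure ℚ` and `σ : ℚ̄ →+* ℂ` an embedding. The **cohomological periods** of
`ℚ̄` along `σ` are the complex numbers `∫_γ ω` where `(X, D)` runs over pairs of `ℚ̄`-varieties,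
`ω ∈ Hⁱ_dR(X, D)` over relative algebraic de Rham cohomology and `γ ∈ Hᵢ(X_σ(ℂ), D_σ(ℂ); ℚ)` over
relative singular homology of the complex points (prelude C10,
`Literature.AlgebraicGeometry.Motives.RelativePeriodData.cohomologicalPeriods`). The **naive (effective) Kontsevich–Zagier
periods** are the absolutely convergent integrals of rational functions with rational
coefficients over `ℚ`-semialgebraic domains (`Literature.NumberTheory.Transcendental.periods`, prelude `KZPeriods`).

The target statement **periods.S34** (Kontsevich–Zagier, *Periods* (2001), §1.1–1.2, stated
without proof; proved as the *Period Theorem* of Huber–Müller-Stach: draft Part III (2015),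
Def. 9.3.1, Thm. 11.2.1 (Friedrich) and Thm. 11.2.4 = *Periods and Nori motives* (2017), Ch. 11 and
Thm. 12.2.1, §12.2) says that, for the classical cohomology theories, the two sets coincide, so
that in particular the set of periods is a countable `ℚ̄`-subalgebra of `ℂ` independent of `σ`.

## Main definitions and results

* `Literature.Periods.CohomologicalPeriodsEqStatement P R σ` : **periods.S34** as a *predicate*: the
  statement `R.cohomologicalPeriods σ = Literature.periods` for relative period data `R` over a period
  realization `P` of `ℚ̄` and an embedding `σ`.
* `Literature.NumberTheory.Transcendental.ExistsCohomologicalPeriodsEqPeriods` : **periods.S34** in *closed form*: there exist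
  a period realization `P` of `ℚ̄` and relative period data `R` over `P` with
  `R.cohomologicalPeriods σ = Literature.periods` for every `σ` (witnessed, by the Period Theorem, by the
  classical data, which the tree cannot name); a named fact.
* `Literature.NumberTheory.Transcendental.countable_cohomologicalPeriods`,
  `Literature.NumberTheory.Transcendental.exists_subalgebra_coe_eq_cohomologicalPeriods`,
  `Literature.NumberTheory.Transcendental.mem_cohomologicalPeriods_of_isAlgebraic` : consequences (real proofs; the named
  facts `periods_countable`, `exists_subring_coe_eq_periods`, `isPeriod_of_isAlgebraic` of
  `KZPeriods` — and, for `periodSetOf_subset_periods`, `periodSetOf_subset_periodsOfPair` and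
  `IsSmoothProjective.isVarietyPair_ofScheme` of `RelativePeriods` — enter as hypotheses).
* `Literature.Periods.CohomologicalPeriodsIndependentStatement R` : the predicate "the set of
  cohomological periods of `R` does not depend on the embedding `σ : ℚ̄ →+* ℂ`"
  (Huber–Müller-Stach 2015, Cor. 9.3.5 (2); 2017, §11.1 and Cor. 12.2.2); it follows from
  **periods.S34** for all `σ` (`cohomologicalPeriodsIndependent_of_forall`), and the closed fact
  yields data satisfying both (`ExistsCohomologicalPeriodsEqPeriods.exists_independent`).
* `Literature.NumberTheory.Transcendental.periodSpaceOfPair_le_span_cohomologicalPeriods`,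
  `Literature.NumberTheory.Transcendental.periodSetOf_subset_periods` : the period space of a pair, resp. the periods of a
  smooth projective variety in the sense of `P`, lie in (the `ℚ`-span of) `Literature.NumberTheory.Transcendental.periods`.

## Design notes

* Mathlib: searched `period`, `Kontsevich`, `deRham`, `semialgebraic` — Mathlib has no periods,
  no algebraic de Rham cohomology of varieties and no comparison isomorphism; we use
  `AlgebraicClosure ℚ : Type` (Mathlib) for `ℚ̄` and the accepted H21 preludes for everything
  else.
* `RelativePeriodData P` is a *hypothesis structure*: it axiomatises relative de Rham cohomology
  and the period pairing but does not single out the classical construction. Hence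
  **periods.S34** is recorded as the predicate `CohomologicalPeriodsEqStatement P R σ`, with its
  binders written at the definition (not supplied by `variable … in`), so that a reader — or a
  tool — looking at `def … : Prop` sees a predicate and not a closed statement. It is a theorem
  (the Period Theorem) for the classical realization and is *not* asserted for arbitrary `R`;
  the corollaries take the statement as a hypothesis `h`.
* The universal closure `∀ P R σ, CohomologicalPeriodsEqStatement P R σ` is not only unproved but
  refutable as soon as the hypothesis structures are inhabited at all, so it must not be vendored
  as a fact. Sketch: fix `λ ∈ ℂˣ` and data `(P, R)`. On pairs of varieties replace each pairing
  `⟨ω, γ⟩` on `Hⁱ(X, D) × Hᵢ(X_σ(ℂ), D_σ(ℂ); ℚ)` by `⟨ω, θ γ⟩`, where `θ` acts on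
  `Hᵢ(X_σ(ℂ), D_σ(ℂ); ℂ) = ⊕ I^{p,q}` (Deligne's functorial splitting of the mixed Hodge
  structure; Cattani–El Zein–Griffiths–Lê 2014, (3.2.1) and p. 159 (ii)) by `λ^{p+q+i}` on
  `I^{p,q}`; off pairs of varieties, where the structures impose nothing beyond functoriality,
  re-extend `H`, the pairings and `P.dR` by left Kan extension (filtered colimits over maps to
  pairs of varieties). Push-forwards along morphisms of pairs of varieties are morphisms of mixed
  Hodge structures, so naturality (`pairing_map`) persists; `θ` is invertible, so perfectness
  persists; and for `X` smooth projective `Hᵢ(X_σ(ℂ); ℚ)` is pure of weight `-i`, so `θ = id`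
  there and `pairing_ofScheme` persists. On `(𝔾_m, ∅)`, `i = 1` (weight `-2`), the non-zero
  periods `c · σ(ℚ̄ˣ)` (perfectness; classically `c = 2πi`, Huber–Müller-Stach 2015, Ex. 9.1.4)
  become `c · σ(ℚ̄ˣ) / λ`, which misses the countable set `Literature.NumberTheory.Transcendental.periods` for all but countably
  many `λ`. The same twist applied at one embedding only refutes the universal closure of
  `CohomologicalPeriodsIndependentStatement`.
* The closed form of the printed theorem available in this vocabulary is therefore the existence
  statement `ExistsCohomologicalPeriodsEqPeriods`. It quantifies `σ` universally: for the
  classical data over the abstract field `AlgebraicClosure ℚ` and any `σ`, base change along `σ`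
  identifies pairs over `ℚ̄` with pairs over the subfield `σ(ℚ̄) ⊂ ℂ`, which is the algebraic
  closure of `ℚ` in `ℂ`, i.e. the field `ℚ̄ ⊂ ℂ` of the sources; so each instance is the printed
  theorem. Discharging it means *constructing* the classical `P` and `R` (Huber–Müller-Stach
  2017, Part I: algebraic de Rham cohomology of pairs, the period isomorphism) and formalising
  Ch. 12 (semialgebraic triangulations, resolution of singularities): a theory, not a lemma.
* "`ℚ̄`-subalgebra of `ℂ`" is rendered as: a `ℚ`-subalgebra of `ℂ` containing every complex
  number algebraic over `ℚ` (there is no canonical `Algebra (AlgebraicClosure ℚ) ℂ` instance, and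
  we do not introduce one).
* Numbering: the theorem numbers quoted from `HuberMullerStachPeriodsIII2015` are those of the
  held 2015 draft of Part III, whose Chapters 9, 11, 12 are Chapters 11, 12, 13 of the 2017 book.

## References

* M. Kontsevich, D. Zagier, *Periods*, in Mathematics Unlimited — 2001 and Beyond, Springer
  (2001), 771–808, §1.1, §1.2 (`KontsevichZagier2001`, `KontsevichZagierPeriods2001`).
* A. Huber, S. Müller-Stach, *Periods and Nori motives. Part III: Periods*, draft of
  August 4, 2015 (`HuberMullerStachPeriodsIII2015`), Def. 9.3.1, Cor. 9.3.5, Ex. 9.1.4,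
  Def. 11.1.3, Thm. 11.2.1, Thm. 11.2.4.
* A. Huber, S. Müller-Stach, *Periods and Nori motives*, Springer (2017), Ch. 11, Thm. 12.2.1,
  §12.2 (`HuberMullerStachPeriods2017`).
* E. Cattani, F. El Zein, P. Griffiths, Lê D. T. (eds.), *Hodge theory*, Princeton (2014), Ch. 3,
  (3.2.1) (`CattaniElZeinGriffithsLe2014`).
-/

noncomputable section

namespace Literature.NumberTheory.Transcendental

section Periods

variable {P : Literature.AlgebraicGeometry.Motives.PeriodRealization (AlgebraicClosure ℚ)} {R : Literature.AlgebraicGeometry.Motives.RelativePeriodData P}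
  {σ : AlgebraicClosure ℚ →+* ℂ}

/-- **periods.S34** (cohomological periods = Kontsevich–Zagier periods), as a *predicate* on
relative period data. For a period realization `P` of `ℚ̄`, relative period data `R` over `P`
and an embedding `σ : ℚ̄ →+* ℂ`, `CohomologicalPeriodsEqStatement P R σ` says that the set of
cohomological periods `{∫_γ ω | (X, D) pair of ℚ̄-varieties, ω ∈ Hⁱ_dR(X, D),
γ ∈ Hᵢ(X_σ(ℂ), D_σ(ℂ); ℚ)}` of `R` along `σ` (Huber–Müller-Stach 2015, Def. 9.3.1: `ℙ^eff(ℚ̄)`)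
equals the set `Literature.NumberTheory.Transcendental.periods` of effective Kontsevich–Zagier periods — absolutely convergent
integrals of rational functions with rational coefficients over `ℚ`-semialgebraic domains
(Kontsevich–Zagier 2001, §1.1; Huber–Müller-Stach 2015, Def. 11.1.3: `ℙ^eff_KZ`). In print this
is a theorem about the *classical* data (algebraic de Rham cohomology of pairs, singular
homology of the complex points, the period pairing): Kontsevich–Zagier 2001, §1.2 (without
proof); Huber–Müller-Stach 2015, Thm. 11.2.1 (Friedrich: `ℙ^eff(ℚ) = ℙ^eff_nc(ℚ) = ℙ^eff_nv`,
with `ℙ^eff(ℚ) = ℙ^eff(ℚ̄)` by Cor. 9.3.5 (2)) and Thm. 11.2.4 (`ℙ^eff_KZ = ℙ^eff_nv = ℙ^eff`)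
= Huber–Müller-Stach 2017, Thm. 12.2.1 and §12.2. It is **not** asserted for every `R`: the
axioms of `RelativePeriodData` do not determine the pairing on classes of impure weight, and the
universal closure over `(P, R, σ)` fails in the twisted model of the module docstring; the
closed form of the theorem is `ExistsCohomologicalPeriodsEqPeriods`.
[cite: KontsevichZagier2001, §1.1–§1.2]
[cite: HuberMullerStachPeriodsIII2015, Def. 9.3.1, Thm. 11.2.1, Thm. 11.2.4] -/
def CohomologicalPeriodsEqStatement (P : Literature.AlgebraicGeometry.Motives.PeriodRealization (AlgebraicClosure ℚ))
    (R : Literature.AlgebraicGeometry.Motives.RelativePeriodData P) (σ : AlgebraicClosure ℚ →+* ℂ) : Prop :=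
  R.cohomologicalPeriods σ = Literature.NumberTheory.Transcendental.periods

/-- Unfolding `CohomologicalPeriodsEqStatement`. [folklore] -/
lemma cohomologicalPeriodsEqStatement_iff :
    CohomologicalPeriodsEqStatement P R σ ↔ R.cohomologicalPeriods σ = Literature.NumberTheory.Transcendental.periods :=
  Iff.rfl

/-- **periods.S34, closed form** (the Period Theorem; Kontsevich–Zagier 2001, §1.2;
Huber–Müller-Stach 2015, Thm. 11.2.1 and Thm. 11.2.4 = 2017, Thm. 12.2.1, §12.2). There exist a
period realization `P` of `ℚ̄ = AlgebraicClosure ℚ` and relative period data `R` over `P` such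
that, for every embedding `σ : ℚ̄ →+* ℂ`, the cohomological periods of `R` along `σ` are exactly
the effective Kontsevich–Zagier periods: `R.cohomologicalPeriods σ = Literature.periods`. The printed
theorem is this equality for the *classical* data — algebraic de Rham cohomology of pairs
(Huber–Müller-Stach 2017, Part I, Ch. 3), relative singular homology of the complex points and
the period pairing `(ω, γ) ↦ ∫_γ ω` (ibid., Part I; 2015, Def. 9.3.1) — over the subfield
`ℚ̄ ⊂ ℂ`; for the abstract algebraic closure and an arbitrary `σ`, base change of pairs along `σ`
identifies it with the same statement over `σ(ℚ̄)`, the algebraic closure of `ℚ` in `ℂ`. The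
tree has no construction of algebraic de Rham cohomology, so the classical data cannot be named
and the theorem is recorded as the existence of a witness. Logically this closed form therefore
comprises two cited claims: (a) the classical data satisfy the axioms of the hypothesis
structures `PeriodRealization ℚ̄` (`DeRhamRealization`, `BettiHodgeData`, the comparison) and
`RelativePeriodData`, each axiom being the classical theorem cited at that field in
`PeriodComparison`/`RelativePeriods` (the structures carry data, but no axioms beyond
functoriality, off pairs of varieties resp. smooth projective varieties, where the classical
functors may be extended by filtered colimits over maps to pairs of varieties); and (b) the
Period Theorem for these data. It is implied by the intended reading of
`CohomologicalPeriodsEqStatement` (the predicate at the classical data, for all `σ`), and no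
sharper closed statement is available before the classical data are constructed; discharging it
requires constructing the classical `P`, `R` and formalising Huber–Müller-Stach 2017, Ch. 12
(semi-algebraic triangulation, resolution of singularities): a theory.
[cite: HuberMullerStachPeriodsIII2015, Thm. 11.2.1 and Thm. 11.2.4]
[cite: KontsevichZagier2001, §1.2] -/
def ExistsCohomologicalPeriodsEqPeriods : Prop :=
  ∃ (P : Literature.AlgebraicGeometry.Motives.PeriodRealization (AlgebraicClosure ℚ)) (R : Literature.AlgebraicGeometry.Motives.RelativePeriodData P),
    ∀ σ : AlgebraicClosure ℚ →+* ℂ, CohomologicalPeriodsEqStatement P R σ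

/-- Unfolding `ExistsCohomologicalPeriodsEqPeriods`. [folklore] -/
lemma existsCohomologicalPeriodsEqPeriods_iff :
    ExistsCohomologicalPeriodsEqPeriods ↔
      ∃ (P : Literature.AlgebraicGeometry.Motives.PeriodRealization (AlgebraicClosure ℚ)) (R : Literature.AlgebraicGeometry.Motives.RelativePeriodData P),
        ∀ σ : AlgebraicClosure ℚ →+* ℂ, R.cohomologicalPeriods σ = Literature.NumberTheory.Transcendental.periods :=
  Iff.rfl

/-- Under **periods.S34**, the set of cohomological periods is countable (Kontsevich–Zagier 2001,
§1.1: `P` is countable; Huber–Müller-Stach 2017, Thm. 12.2.1), given the named fact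
`Literature.NumberTheory.Transcendental.periods_countable` as hypothesis `hc`. [cite: KontsevichZagier2001, §1.1:  P  is countable] -/
theorem countable_cohomologicalPeriods (hc : periods_countable)
    (h : CohomologicalPeriodsEqStatement P R σ) : (R.cohomologicalPeriods σ).Countable := by
  rw [h]
  exact hc

/-- Under **periods.S34**, every complex number algebraic over `ℚ` is a cohomological period
(`ℚ̄ ⊆ P`; Kontsevich–Zagier 2001, §1.1), given the named fact `Literature.NumberTheory.Transcendental.isPeriod_of_isAlgebraic` as
hypothesis `hP`. [cite: KontsevichZagier2001, §1.1] -/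
theorem mem_cohomologicalPeriods_of_isAlgebraic (hP : isPeriod_of_isAlgebraic)
    (h : CohomologicalPeriodsEqStatement P R σ) {z : ℂ} (hz : IsAlgebraic ℚ z) :
    z ∈ R.cohomologicalPeriods σ := by
  rw [h]
  exact hP z hz

/-- Under **periods.S34**, the cohomological periods form a `ℚ`-subalgebra of `ℂ` containing all
algebraic numbers, i.e. a `ℚ̄`-subalgebra of `ℂ` (Kontsevich–Zagier 2001, §1.1;
Huber–Müller-Stach 2017, Prop. 11.1.7 and Thm. 12.2.1), given the named facts
`Literature.NumberTheory.Transcendental.exists_subring_coe_eq_periods` (`hS`) and `Literature.NumberTheory.Transcendental.isPeriod_of_isAlgebraic` (`hP`). [cite: KontsevichZagier2001, §1.1] -/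
theorem exists_subalgebra_coe_eq_cohomologicalPeriods (hS : exists_subring_coe_eq_periods)
    (hP : isPeriod_of_isAlgebraic) (h : CohomologicalPeriodsEqStatement P R σ) :
    ∃ A : Subalgebra ℚ ℂ, (A : Set ℂ) = R.cohomologicalPeriods σ ∧
      ∀ z : ℂ, IsAlgebraic ℚ z → z ∈ A := by
  obtain ⟨S, hS⟩ := hS
  refine ⟨{ S with
    algebraMap_mem' := fun q ↦ ?_ }, ?_, fun z hz ↦ ?_⟩
  · change (algebraMap ℚ ℂ q) ∈ (S : Set ℂ)
    rw [hS]
    exact hP _ (isAlgebraic_algebraMap q)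
  · change (S : Set ℂ) = _
    rw [hS, h]
  · change z ∈ (S : Set ℂ)
    rw [hS]
    exact hP z hz

/-- The *predicate* that the set of cohomological periods of the relative period data `R` over
`ℚ̄` does not depend on the embedding `σ : ℚ̄ →+* ℂ` (Huber–Müller-Stach 2015, Cor. 9.3.5 (2) with
§11.2 = 2017, §11.1 and Cor. 12.2.2: for the classical data and `k = ℚ̄` all embeddings give the
same set, namely `P`). Like `CohomologicalPeriodsEqStatement` it is a property of `R`, not
asserted for arbitrary `R` (the twist of the module docstring applied at a single embedding
refutes its universal closure); it follows from **periods.S34** for all `σ`.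
[cite: HuberMullerStach2017, §11.1 and Cor. 12.2.2: for  k = ℚ̄  all] -/
def CohomologicalPeriodsIndependentStatement (R : Literature.AlgebraicGeometry.Motives.RelativePeriodData P) : Prop :=
  ∀ σ σ' : AlgebraicClosure ℚ →+* ℂ, R.cohomologicalPeriods σ = R.cohomologicalPeriods σ'

/-- **periods.S34** for all embeddings implies independence of the embedding
(Huber–Müller-Stach 2017, Cor. 12.2.2). [cite: HuberMullerStach2017, Cor. 12.2.2] -/
theorem cohomologicalPeriodsIndependent_of_forall
    (h : ∀ σ : AlgebraicClosure ℚ →+* ℂ, CohomologicalPeriodsEqStatement P R σ) :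
    CohomologicalPeriodsIndependentStatement R :=
  fun σ σ' ↦ (h σ).trans (h σ').symm

/-- The closed form of **periods.S34** yields relative period data over `ℚ̄` whose cohomological
periods are the Kontsevich–Zagier periods along every embedding and, in particular, do not
depend on the embedding (Huber–Müller-Stach 2017, Thm. 12.2.1 and Cor. 12.2.2).
[cite: HuberMullerStachPeriodsIII2015, Thm. 11.2.1 and Cor. 9.3.5 (2)] -/
theorem ExistsCohomologicalPeriodsEqPeriods.exists_independent
    (h : ExistsCohomologicalPeriodsEqPeriods) :
    ∃ (P : Literature.AlgebraicGeometry.Motives.PeriodRealization (AlgebraicClosure ℚ)) (R : Literature.AlgebraicGeometry.Motives.RelativePeriodData P),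
      CohomologicalPeriodsIndependentStatement R ∧
        ∀ σ : AlgebraicClosure ℚ →+* ℂ, CohomologicalPeriodsEqStatement P R σ := by
  obtain ⟨P, R, hR⟩ := h
  exact ⟨P, R, cohomologicalPeriodsIndependent_of_forall hR, hR⟩

/-- Under **periods.S34**, the period space `𝒫⟨Hⁱ(X, D)⟩ ⊆ ℂ` of a pair of `ℚ̄`-varieties is
contained in the `ℚ`-span of the Kontsevich–Zagier periods (Huber–Müller-Stach 2017, §11.1;
Kontsevich–Zagier 2001, §1.2: "periods of varieties are periods"). [cite: HuberMullerStach2017, §11.1] -/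
theorem periodSpaceOfPair_le_span_cohomologicalPeriods (h : CohomologicalPeriodsEqStatement P R σ)
    {Y : Literature.AlgebraicGeometry.Motives.SchemePair (AlgebraicClosure ℚ)} (hY : Y.IsVarietyPair) (i : ℕ) :
    R.periodSpaceOfPair σ Y i ≤ Submodule.span ℚ Literature.NumberTheory.Transcendental.periods :=
  h ▸ R.periodSpaceOfPair_le_span hY i

/-- Under **periods.S34**, the periods of a pair of `ℚ̄`-varieties are Kontsevich–Zagier periods
(Kontsevich–Zagier 2001, §1.2). [cite: KontsevichZagier2001, §1.2] -/
theorem periodsOfPair_subset_periods (h : CohomologicalPeriodsEqStatement P R σ)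
    {Y : Literature.AlgebraicGeometry.Motives.SchemePair (AlgebraicClosure ℚ)} (hY : Y.IsVarietyPair) (i : ℕ) :
    R.periodsOfPair σ Y i ⊆ Literature.NumberTheory.Transcendental.periods :=
  h ▸ R.periodsOfPair_subset_cohomologicalPeriods hY i

/-- Under **periods.S34**, the periods `∫_γ ω`, `ω ∈ Hⁱ_dR(X)`, `γ ∈ Hᵢ(X_σ(ℂ); ℚ)`, of a smooth
projective `ℚ̄`-variety `X` in the sense of the period realization `P` (prelude C9,
`P.periodSetOf`) are Kontsevich–Zagier periods (Kontsevich–Zagier 2001, §1.2; via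
`RelativePeriodData.periodSetOf_subset_periodsOfPair`, a named fact taken as hypothesis `hR`,
and `IsSmoothProjective.isVarietyPair_ofScheme`, hypothesis `hV`). [cite: KontsevichZagier2001, §1.2] -/
theorem periodSetOf_subset_periods (hR : R.periodSetOf_subset_periodsOfPair σ)
    (hV : Literature.AlgebraicGeometry.Motives.IsSmoothProjective.isVarietyPair_ofScheme (k := AlgebraicClosure ℚ))
    (h : CohomologicalPeriodsEqStatement P R σ) {n : ℕ}
    {X : Literature.AlgebraicGeometry.Motives.SchemeOver (AlgebraicClosure ℚ)} (hX : Literature.AlgebraicGeometry.Motives.IsSmoothProjective n X) (i : ℕ) :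
    P.periodSetOf σ X i ⊆ Literature.NumberTheory.Transcendental.periods :=
  (hR hX i).trans (periodsOfPair_subset_periods h (hV hX) i)

end Periods

end Literature.NumberTheory.Transcendental

end
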